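import Summits.ValiantsHypothesis.ValiantsHypothesis.Theses.DetQP
import Summits.ValiantsHypothesis.ValiantsHypothesis.Theses.LacunarySymmetroid
import Summits.ValiantsHypothesis.ValiantsHypothesis.Theorems.FreeFermionCLLDcqpToVH
import Summits.ValiantsHypothesis.ValiantsHypothesis.Theorems.LacunarySymmetroidPencilTransfer
import Summits.ValiantsHypothesis.ValiantsHypothesis.Theorems.LacunarySymmetroidThetaWitness
import Summits.ValiantsHypothesis.ValiantsHypothesis.Theorems.DetqpThesis.Negative.NotQPBoundedOfExp
import Summits.ValiantsHypothesis.ValiantsHypothesis.Theorems.ProjectionStabilityOptStepStubGrenetLeftEquivariant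
import Literature.Computability.AlgebraicComplexity.LandsbergRessayreProofs
import Literature.Computability.AlgebraicComplexity.DeterminantalComplexityProofs
import Literature.Computability.AlgebraicComplexity.OrbitClosureProofs
import Literature.Computability.AlgebraicComplexity.QPBoundedClosure
import HarnessLib

/-!
# What would suffice — the LMR corpus (Mignon–Ressayre, Landsberg–Manivel–Ressayre, Landsberg–Ressayre,
# Alper–Bogart–Velasco, Grenet, Hüttenhain–Ikenmeyer, GKKP, Cai–Chen–Li / Yabe) against rungs V0 / V1 / V6

val-lit bookkeeping file (unit `val-lit-lead-lmr`, D-0074). HONEST FRAMING: nothing in this file is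
progress on `VP ≠ VNP`; it records, as kernel-checked implications ending in EXISTING rung
declarations, exactly which open statement of each source's method family would suffice, so that
the typed literature sections (`Literature/Computability/AlgebraicComplexity/*`, val-lit typers
t10–t17) can be joined to the routes by name. Every open link is a HYPOTHESIS `(h : …)`; no
conjecture is asserted and no new `Prop` is introduced.

Rungs (existing decls): `_root_.ValiantsHypothesis` (= `Literature.PNP.ValiantHypothesis ℂ`,
`VP ℂ ≠ VNP ℂ`); route DetQP: `Theses.DetQP.DetqpThesis` (V0: `dc(per_n)` is not quasi-polynomially
bounded), `Theses.DetQP.DetqpSymmetrization` (rank-3 crux), `Theses.DetQP.DcqpToVH` (CLOSED,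
`Summit.ValiantsHypothesis.Theorems.dcqpToVH_proof_detQP`: Valiant 1979 + Toda/Malod–Portier +
VSBR, quasi-polynomial form), `Theses.DetQP.closes`; route LacunarySymmetroid (V1):
`Theses.LacunarySymmetroid.MatrixDescartes` (open crux), `PencilTransfer`, `ThetaWitness` (CLOSED).

## The chains

* **Engine template** (`detqpThesis_of_eventual_lower_bound`,
  `valiantsHypothesis_of_eventual_lower_bound`): ANY eventual lower bound
  `g n ≤ dc(per_n)` with `g` not quasi-polynomially bounded gives `DetqpThesis`, hence
  `ValiantsHypothesis` (through the closed `DcqpToVH`). Every lower-bound engine of the corpus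
  instantiates the comparison half with a quasi-polynomially (indeed quadratically) bounded `g` —
  Mignon–Ressayre 2004 `n²/2` (PROVED in tree: `sq_le_two_mul_determinantalComplexity_perPoly_complex_holds`,
  MignonRessayreBound.lean), Cai–Chen–Li 2010 `(n−2)(n−3)/2` in char `p`, Alper–Bogart–Velasco 2017
  `codim Sing + 1 ≤ 2n + 1`, Yabe 2015 `(n−1)² + 1` over `ℝ`, Landsberg–Manivel–Ressayre 2013 `m²/2`
  for border complexity (`LMR2013_thm_1_1_1_holds`) — and a quadratically bounded `g` is
  quasi-polynomially bounded (`IsQPBounded.mul/pow`, QPBoundedClosure.lean), so none of them can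
  discharge the growth half: the open step of this whole family is a bound past `n^{2+ε}`
  (`Theses.DetQP.DetqpSuperquadratic`, itself still short of `DetqpThesis`).
* **Grenet optimality** (`valiantsHypothesis_of_grenet_optimal`): `2^n − 1 ≤ dc(per_n)` eventually
  (optimality of Grenet 2011, known for `n = 3` only: Alper–Bogart–Velasco 2017 Cor. 1.4,
  `alperBogartVelasco2017_cor_1_4_holds`) would suffice.
* **Border complexity** (`detqpThesis_of_border_not_qp`): `dc̄(per_n)` not quasi-polynomially
  bounded suffices (LMR 2013's model; PROVED comparison `borderDetComplexityPer_le_holds`).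
* **Symmetrisation at quasi-polynomial cost** (Landsberg–Ressayre 2017, Question 2.2 / Cor. 2.3,
  in the weakest form the tree can use): if every affine determinantal representation of `per_m`
  of size `s` can be traded for one of size `2^{polylog s}` that is equivariant for the LEFT
  monomial symmetries `x ↦ g·x` (`leftMonomialSubst ℂ m` = LR's `N(T^{GL(E)})`), then the PROVED
  Thm. 2.8 (`lr_left_equivariant_lower_holds`: such representations have size `≥ 2^m − 1`) and
  `qp ∘ qp = qp` give `DetqpThesis` (`detqpThesis_of_leftQPSymmetrization`). The route's crux
  `DetqpSymmetrization` (equivariance for the closure of the `(P_π · diag d) ⊗ 1`, `d_i ≠ 0`) is the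
  special case: `leftMonomialSubst_le_detqpGroup` + antitonicity, so
  `detqpThesis_of_detqpSymmetrization : DetqpSymmetrization → DetqpThesis` and
  `valiantsHypothesis_of_detqpSymmetrization` — i.e. crux 0319 alone now decides the route.
* **V1 dictionary** (`valiantsHypothesis_of_matrixDescartes`): with `PencilTransfer` (GKKP 2011-type
  symmetric pencils: VP ⇒ quasi-polynomial symmetric lacunary pencil with the same real zero set)
  and `ThetaWitness` CLOSED, the real-root count `MatrixDescartes` alone implies
  `ValiantsHypothesis`.

References: T. Mignon, N. Ressayre, *A quadratic bound for the determinant and permanent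
problem*, IMRN 2004:79, 4241–4253, Thm. 1; J. M. Landsberg, L. Manivel, N. Ressayre, *Hypersurfaces
with degenerate duals and the geometric complexity theory program*, Comment. Math. Helv. 88 (2013),
arXiv:1004.4802, Thm. 1.1.1; J. M. Landsberg, N. Ressayre, *Permanent v. determinant: an exponential
lower bound assuming symmetry and a potential path towards Valiant's conjecture*, Differential Geom.
Appl. 55 (2017), arXiv:1508.05788, Thm. 2.8, Question 2.2, Cor. 2.3; J. Alper, T. Bogart,
M. Velasco, *A lower bound for the determinantal complexity of a hypersurface*, Found. Comput. Math.
17 (2017), arXiv:1505.02205, Cor. 1.4, Rem. 1.5; B. Grenet, *An upper bound for the permanent versus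
determinant problem* (2011); B. Grenet, E. Kaltofen, P. Koiran, N. Portier, *Symmetric determinantal
representation of weakly-skew circuits*, Contemp. Math. 556 (2011), arXiv:1007.3804, Thms. 4–5;
J.-Y. Cai, X. Chen, D. Li, *Quadratic lower bound for permanent vs. determinant in any
characteristic*, comput. complex. 19 (2010), Thm. 2.3; A. Yabe, *Bi-polynomial rank and
determinantal complexity*, arXiv:1504.00151, Thm. 1.7; P. Bürgisser, *Completeness and Reduction in
Algebraic Complexity Theory*, Springer 2000, §2.5 (quasi-polynomial bookkeeping).
-/

set_option linter.dupNamespace false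

namespace Summit.ValiantsHypothesis.ValiantsHypothesis.Theorems.LMRWhatWouldSuffice

open Literature.Computability.AlgebraicComplexity
open Summit.ValiantsHypothesis.Theorems.DetqpThesis.Negative
open scoped Kronecker

noncomputable section

/-! ### Quasi-polynomial bookkeeping -/

/-- **qp ∘ qp = qp**: along a quasi-polynomially bounded `t`, `n ↦ 2 ^ ((log₂ (t n) + c) ^ c)` is
quasi-polynomially bounded (`log₂ (t n) ≤ (log₂ n + k)^k`, then
`((L + K)^K)^c ≤ (L + K c + K)^(K c + K)`; the `IsPBounded` version is
`IsQPBounded.two_pow_qexp_log`). Bürgisser 2000, §2.5 (composition of quasi-polynomial bounds).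
[folklore] -/
theorem isQPBounded_two_pow_qexp_log_of_isQPBounded {t : ℕ → ℕ} (ht : IsQPBounded t) (c : ℕ) :
    IsQPBounded fun n => 2 ^ ((Nat.log 2 (t n) + c) ^ c) := by
  obtain ⟨k, hk⟩ := ht
  refine ⟨(max k c + 2) * c + (max k c + 2), fun n => Nat.pow_le_pow_right Nat.two_pos ?_⟩
  have h1 : Nat.log 2 (t n) ≤ (Nat.log 2 n + k) ^ k :=
    calc Nat.log 2 (t n) ≤ Nat.log 2 (2 ^ ((Nat.log 2 n + k) ^ k)) := Nat.log_mono_right (hk n)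
      _ = (Nat.log 2 n + k) ^ k := Nat.log_pow Nat.one_lt_two _
  have h2 : Nat.log 2 (t n) + c ≤ (Nat.log 2 n + (max k c + 2)) ^ (max k c + 2) := by
    have ha := IsQPBounded.qexp_mono (Nat.log 2 n) (le_max_left k c)
    have hb := (IsQPBounded.le_qexp (Nat.log 2 n) c).trans
      (IsQPBounded.qexp_mono (Nat.log 2 n) (le_max_right k c))
    have h3 := IsQPBounded.three_mul_qexp_le (Nat.log 2 n) (max k c)
    omega
  calc (Nat.log 2 (t n) + c) ^ c ≤ ((Nat.log 2 n + (max k c + 2)) ^ (max k c + 2)) ^ c :=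
        Nat.pow_le_pow_left h2 c
    _ = (Nat.log 2 n + (max k c + 2)) ^ ((max k c + 2) * c) := by rw [← pow_mul]
    _ ≤ (Nat.log 2 n + ((max k c + 2) * c + (max k c + 2))) ^ ((max k c + 2) * c) :=
        Nat.pow_le_pow_left (by omega) _
    _ ≤ (Nat.log 2 n + ((max k c + 2) * c + (max k c + 2))) ^
          ((max k c + 2) * c + (max k c + 2)) :=
        Nat.pow_le_pow_right (by omega) (by omega)

/-! ### The engine template (V0 → V6) -/

/-- **Engine template, `dc` form.** Any eventual lower bound `g n ≤ dc(per_n)` by a function `g`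
that is not quasi-polynomially bounded gives `DetqpThesis` (route DetQP, V0). This is the shape
every engine of the corpus (Hessian rank, dual varieties, singular locus, bi-polynomial rank) would
have to reach; all of them currently give quadratically bounded `g` (Mignon–Ressayre:
`sq_le_two_mul_determinantalComplexity_perPoly_complex_holds` gives the comparison half with
`g n = n² / 2`, which is quasi-polynomially bounded, so the growth half fails). Mignon–Ressayre 2004,
Thm. 1 (the model); bookkeeping `not_isQPBounded_of_eventually_le`. [folklore] -/
theorem detqpThesis_of_eventual_lower_bound {g : ℕ → ℕ} (hg : ¬ IsQPBounded g)
    (h : ∃ n₀, ∀ n ≥ n₀, g n ≤ determinantalComplexity (perPoly (Fin n) ℂ)) :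
    Theses.DetQP.DetqpThesis := by
  unfold Theses.DetQP.DetqpThesis
  exact not_isQPBounded_of_eventually_le hg h

/-- **Engine template, summit form.** The same hypothesis gives `VP ℂ ≠ VNP ℂ`, through the route's
deciding theorem `Theses.DetQP.closes` and the CLOSED transfer `DcqpToVH` (Valiant 1979 universality,
VSBR 1983 depth reduction in quasi-polynomial form; `dcqpToVH_proof_detQP`). [folklore] -/
theorem valiantsHypothesis_of_eventual_lower_bound {g : ℕ → ℕ} (hg : ¬ IsQPBounded g)
    (h : ∃ n₀, ∀ n ≥ n₀, g n ≤ determinantalComplexity (perPoly (Fin n) ℂ)) :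
    _root_.ValiantsHypothesis :=
  Theses.DetQP.closes (detqpThesis_of_eventual_lower_bound hg h)
    Summit.ValiantsHypothesis.Theorems.dcqpToVH_proof_detQP

/-- **Grenet optimality would suffice.** If Grenet's `2^n − 1` (PROVED upper bound
`determinantalComplexity_perPoly_le_holds`) is eventually optimal, `VP ℂ ≠ VNP ℂ` follows; known only
for `n = 3` (`alperBogartVelasco2017_cor_1_4_holds`: `dc(per₃) = 7`). Grenet 2011; Alper–Bogart–Velasco
2017, Cor. 1.4; bookkeeping `not_isQPBounded_two_pow_sub_one`. [folklore] -/
theorem valiantsHypothesis_of_grenet_optimal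
    (h : ∃ n₀, ∀ n ≥ n₀, 2 ^ n - 1 ≤ determinantalComplexity (perPoly (Fin n) ℂ)) :
    _root_.ValiantsHypothesis :=
  valiantsHypothesis_of_eventual_lower_bound not_isQPBounded_two_pow_sub_one h

/-- **Border model (LMR 2013).** If the border determinantal complexity `dc̄(per_n)`
(`borderDetComplexityPer ℂ n`: padded `per_n` in the orbit closure of `det_m`) is not
quasi-polynomially bounded then `DetqpThesis` holds, by the PROVED comparison `dc̄(per_n) ≤ dc(per_n)`
(`borderDetComplexityPer_le_holds`, Mulmuley–Sohoni 2001 Prop. 4.4). LMR 2013's `m² ≤ 2n`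
(`LMR2013_thm_1_1_1_holds`) is this model's quadratic engine. Landsberg–Manivel–Ressayre 2013,
Thm. 1.1.1; Mulmuley–Sohoni 2001, Prop. 4.4. [folklore] -/
theorem detqpThesis_of_border_not_qp
    (h : ¬ IsQPBounded fun n => borderDetComplexityPer ℂ n) : Theses.DetQP.DetqpThesis := by
  unfold Theses.DetQP.DetqpThesis
  exact not_isQPBounded_of_eventually_le h
    ⟨1, fun n hn => borderDetComplexityPer_le_holds (Nat.lt_of_lt_of_le Nat.zero_lt_one hn)⟩

/-! ### Symmetrisation at quasi-polynomial cost (Landsberg–Ressayre 2017, Question 2.2 / Cor. 2.3) -/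

/-- The LEFT monomial symmetries `x ↦ g·x` (`g ∈ N(T) = T ⋊ 𝔖_m`, tree `leftMonomialSubst`) lie in
the symmetry group inlined in the route crux `Theses.DetQP.DetqpSymmetrization` (closure of the
substitutions `(P_π · diag d) ⊗ 1`, all `d_i ≠ 0`): `P_π ⊗ 1` is the generator with `d = 1`, and a
generator `diag d ⊗ 1` that is invertible has all `d_i ≠ 0` (`det (diag d ⊗ 1) = (∏ d_i)^m`), so it
is the generator with `π = 1`. Landsberg–Ressayre 2017, §2.1. [folklore] -/
theorem leftMonomialSubst_le_detqpGroup (m : ℕ) :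
    leftMonomialSubst ℂ m ≤ Subgroup.closure
      {γ : Matrix.GeneralLinearGroup (Fin m × Fin m) ℂ |
        ∃ (π : Equiv.Perm (Fin m)) (d : Fin m → ℂ), (∀ i, d i ≠ 0) ∧
          (γ : Matrix (Fin m × Fin m) (Fin m × Fin m) ℂ) =
            Matrix.kroneckerMap (· * ·) (π.permMatrix ℂ * Matrix.diagonal d) 1} := by
  refine (ProjectionStabilityOptStep.GrenetLeftEquivariant.leftMonomialSubst_le_closure ℂ m).trans
    ((Subgroup.closure_le _).mpr ?_)
  rintro γ (⟨π, hγ⟩ | ⟨d, hγ⟩)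
  · refine Subgroup.subset_closure ⟨π, fun _ => 1, fun _ => one_ne_zero, ?_⟩
    rw [hγ, Matrix.diagonal_one, mul_one]
  · have hdet : (γ : Matrix (Fin m × Fin m) (Fin m × Fin m) ℂ).det ≠ 0 := by
      rw [← Matrix.GeneralLinearGroup.val_det_apply]
      exact (Matrix.GeneralLinearGroup.det γ).ne_zero
    have hd : ∀ i, d i ≠ 0 := by
      intro i hi
      apply hdet
      have hm : Fintype.card (Fin m) ≠ 0 := by
        rw [Fintype.card_fin]
        exact (Fin.pos i).ne'
      rw [hγ, Matrix.det_kronecker, Matrix.det_diagonal,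
        Finset.prod_eq_zero (Finset.mem_univ i) hi, zero_pow hm, zero_mul]
    refine Subgroup.subset_closure ⟨1, d, hd, ?_⟩
    rw [hγ, Matrix.permMatrix_one, one_mul]

/-- **Left quasi-polynomial symmetrisation suffices** (the tree's form of Landsberg–Ressayre 2017,
Cor. 2.3: an affirmative answer to Question 2.2 gives Valiant's conjecture — here with polynomial
weakened to quasi-polynomial and the full symmetry group weakened to the LEFT monomial symmetries,
which is all the PROVED Thm. 2.8 `lr_left_equivariant_lower_holds` needs). Proof: with
`s = dc(per_m)` (attained, `hasDetRepr_determinantalComplexity_holds`) the hypothesis yields a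
left-equivariant representation of size `s' ≤ 2^((log₂ s + c)^c)`, Thm. 2.8 gives `2^m − 1 ≤ s'`, and
`m ↦ 2^((log₂ dc(per_m) + c)^c)` would be quasi-polynomially bounded if `dc(per_m)` were
(`isQPBounded_two_pow_qexp_log_of_isQPBounded`), contradicting `not_isQPBounded_of_eventually_ge`.
Landsberg–Ressayre 2017, Thm. 2.8, Question 2.2, Cor. 2.3. [cite: LandsbergRessayre2017, Cor. 2.3] -/
theorem detqpThesis_of_leftQPSymmetrization
    (h : ∃ c : ℕ, ∀ m s : ℕ, 3 ≤ m → HasDetRepr (perPoly (Fin m) ℂ) s →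
      ∃ s' ≤ 2 ^ ((Nat.log 2 s + c) ^ c),
        HasEquivariantDetRepr (leftMonomialSubst ℂ m) (perPoly (Fin m) ℂ) s') :
    Theses.DetQP.DetqpThesis := by
  obtain ⟨c, hc⟩ := h
  unfold Theses.DetQP.DetqpThesis
  intro hqp
  refine not_isQPBounded_of_eventually_ge
    (t := fun m => 2 ^ ((Nat.log 2 (determinantalComplexity (perPoly (Fin m) ℂ)) + c) ^ c))
    ⟨3, fun m hm => ?_⟩ (isQPBounded_two_pow_qexp_log_of_isQPBounded hqp c)
  obtain ⟨s', hs', A, hA⟩ :=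
    hc m _ hm (hasDetRepr_determinantalComplexity_holds (perPoly (Fin m) ℂ))
  exact (lr_left_equivariant_lower_holds m hm s' A hA).trans hs'

/-- **The route crux `DetqpSymmetrization` (stmt-ValiantsHypothesis-0319) alone implies `DetqpThesis`
(stmt-0315):** its symmetry group contains `leftMonomialSubst ℂ m`
(`leftMonomialSubst_le_detqpGroup`), equivariance is antitone in the group
(`HasEquivariantDetRepr.anti`), and `detqpThesis_of_leftQPSymmetrization` applies.
Landsberg–Ressayre 2017, Thm. 2.8, Cor. 2.3. [cite: LandsbergRessayre2017, Thm. 2.8] -/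
theorem detqpThesis_of_detqpSymmetrization (h : Theses.DetQP.DetqpSymmetrization) :
    Theses.DetQP.DetqpThesis := by
  unfold Theses.DetQP.DetqpSymmetrization at h
  obtain ⟨c, hc⟩ := h
  refine detqpThesis_of_leftQPSymmetrization ⟨c, fun m s hm hs => ?_⟩
  obtain ⟨s', hs', hS⟩ := hc m s hm hs
  exact ⟨s', hs', hS.anti (leftMonomialSubst_le_detqpGroup m)⟩

/-- Summit form: `DetqpSymmetrization → VP ℂ ≠ VNP ℂ` (crux 0319, then the route's `closes` with the
CLOSED `DcqpToVH`). Landsberg–Ressayre 2017, Cor. 2.3 (quasi-polynomial, left-symmetry form).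
[cite: LandsbergRessayre2017, Cor. 2.3] -/
theorem valiantsHypothesis_of_detqpSymmetrization (h : Theses.DetQP.DetqpSymmetrization) :
    _root_.ValiantsHypothesis :=
  Theses.DetQP.closes (detqpThesis_of_detqpSymmetrization h)
    Summit.ValiantsHypothesis.Theorems.dcqpToVH_proof_detQP

/-- Summit form of the left quasi-polynomial symmetrisation hypothesis.
Landsberg–Ressayre 2017, Cor. 2.3. [cite: LandsbergRessayre2017, Cor. 2.3] -/
theorem valiantsHypothesis_of_leftQPSymmetrization
    (h : ∃ c : ℕ, ∀ m s : ℕ, 3 ≤ m → HasDetRepr (perPoly (Fin m) ℂ) s →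
      ∃ s' ≤ 2 ^ ((Nat.log 2 s + c) ^ c),
        HasEquivariantDetRepr (leftMonomialSubst ℂ m) (perPoly (Fin m) ℂ) s') :
    _root_.ValiantsHypothesis :=
  Theses.DetQP.closes (detqpThesis_of_leftQPSymmetrization h)
    Summit.ValiantsHypothesis.Theorems.dcqpToVH_proof_detQP

/-! ### V1: the lacunary-symmetroid dictionary -/

/-- **V1.** With `PencilTransfer` (VP family ⇒ quasi-polynomial-size real SYMMETRIC lacunary pencil
with the same real zero set — the GKKP 2011 / realification dictionary, CLOSED:
`LacunarySymmetroid.pencilTransfer_proof`) and `ThetaWitness` (CLOSED: `thetaWitness_proof`) proved,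
the matrix Descartes bound `MatrixDescartes` (stmt-ValiantsHypothesis-18050, OPEN) alone implies
`VP ℂ ≠ VNP ℂ`. Grenet–Kaltofen–Koiran–Portier 2011, Thm. 4 (symmetric representations);
route LacunarySymmetroid `closes`. [folklore] -/
theorem valiantsHypothesis_of_matrixDescartes (h : Theses.LacunarySymmetroid.MatrixDescartes) :
    _root_.ValiantsHypothesis :=
  Theses.LacunarySymmetroid.closes h LacunarySymmetroid.pencilTransfer_proof
    LacunarySymmetroid.thetaWitness_proof

end

end Summit.ValiantsHypothesis.ValiantsHypothesis.Theorems.LMRWhatWouldSuffice
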